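import Literature.AlgebraicGeometry.CossartJannsenSaito2020.ProjDirProjectiveLineCharts
import Literature.AlgebraicGeometry.Resolution.PointBlowupHsFunMono
import Literature.AlgebraicGeometry.Resolution.BlowupsProperProofs
import HarnessLib

/-!
# CJS LNM 2270, Def. 6.38 (ii) at `e_x(X) = 2`: the closed points of `C_1 = ℙ(Dir_x(X)) ≅ ℙ^1_{k(x)}` have residue
# fields finite over `k(x)` — PROOF of the closed-point clause of `ProjDir_projLine_residueFields`

Source: V. Cossart, U. Jannsen, S. Saito, *Desingularization: Invariants and Strategy*, LNM **2270** (2020)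
[`CossartJannsenSaito2020`], Def. 6.38 (ii) (p. 105) «`C_1 = ℙ(Dir^O_x(X)) ≅ ℙ^1_{k(x)}`». The named fact
`ProjDir_projLine_residueFields` (`ProjDirProjectiveLine.lean`) has two clauses: the generic point of `C_1` has residue
field `k(x)(T)`, and every other point `y ∈ C_1` has `k(x) → k(y)` finite. This file PROVES the second clause
(`finite_residueFieldMap_of_mem_projDirectrixFibre`): such a `y` is a CLOSED point of `X'`
(`projDirectrixFibre_projLine_topology`, `ProjDirProjectiveLineCharts.lean`), and the blow-up `π` is proper
(`IsBlowup.isProper`), in particular locally of finite type, so `k(π y) → k(y)` is finite (Stacks 01TB,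
`finite_residueFieldMap_of_isClosed`). The generic-point clause (an isomorphism `k(η_1) ≅ k(x)(T)` compatible with `π^*`)
is NOT proved here.

NOT a statement of H. Hironaka's manuscript; a PROOF about a typed published statement of [CJS 2020] for the L-lane of
cell res-hironaka ([L W4.2], deal P-a). AI-written; weaker than expert review.

## References

* V. Cossart, U. Jannsen, S. Saito, LNM 2270 (2020), Def. 6.38 (ii), p. 105. [CossartJannsenSaito2020]
* The Stacks Project, Tag 01TB. [StacksProject]
-/

noncomputable section

open CategoryTheory AlgebraicGeometry TopologicalSpace IsLocalRing
open Literature.AlgebraicGeometry.Resolution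

namespace Literature.AlgebraicGeometry.CossartJannsenSaito2020

universe u

/-- **CJS 2020, Def. 6.38 (ii) at `e_x(X) = 2`, closed points of `C_1 ≅ ℙ^1_{k(x)}`, PROVED: at every point `y` of
`C_1 = projDirectrixFibre π x` other than its generic point, the residue field extension `k(π y) = k(x) → k(y)` is
finite** (`y` is closed in `X'` and the blow-up `π` is locally of finite type). Second clause of the named fact
`ProjDir_projLine_residueFields`. [cite: CossartJannsenSaito2020, Def. 6.38 (ii), p. 105] -/
theorem finite_residueFieldMap_of_mem_projDirectrixFibre {X X' : Scheme.{u}} [IsLocallyNoetherian X] (π : X' ⟶ X)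
    (x : X) (hx : IsClosed ({x} : Set X)) (hπ : IsBlowup π (Scheme.IdealSheafData.vanishingIdeal ⟨{x}, hx⟩))
    (hdir : Scheme.dirDim X x = 2) (y : X') (hy : y ∈ projDirectrixFibre π x)
    (hny : ¬ IsGenericPoint y (projDirectrixFibre π x)) : (π.residueFieldMap y).hom.Finite := by
  haveI : IsProper π := hπ.isProper
  have hcl : IsClosed ({y} : Set X') := (projDirectrixFibre_projLine_topology π x hx hπ hdir).2.2.2 y hy hny
  exact finite_residueFieldMap_of_isClosed π hcl

end Literature.AlgebraicGeometry.CossartJannsenSaito2020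

end
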